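import Summits.ABC.ABC.Theorems.TwistAmplificationSharpModerateLawSyzygyTransferCone
import Summits.ABC.ABC.Theorems.TwistAmplificationSharpModerateLawCuspTransferCone
import Summits.ABC.ABC.Theorems.TwistAmplificationSharpModerateLawReduction
import Literature.NumberTheory.CubicFields.MaximalOverring
import Literature.NumberTheory.CubicFields.DeloneFaddeevIrreducible

/-!
# Crux `TwistAmplification.SharpModerateLaw` (stmt-ABC-1975): objects of the line
`unit-plane-conic-two-torsion`

Definitions (and the kernel-checked glue between them) of the picked line
`Cruxes/SharpModerateLaw/Lines/unit-plane-conic-two-torsion.lean` (lead `prover-line-stmt-ABC-1975-c3-0`;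
planner `planner-cruxplan-stmt-ABC-1975-unit-plane-conic-two-0`), REBASED on the landed objects of the
companion line `syzygy-lattice-half-deep-few-primes` (`…SharpModerateLawDefs.lean`: the index-form shell
`ifShell`, the counts `shellCount` / `orbitTotal` / `totalCount`, the syzygy few-deep predicate `FewDeep`,
`depthRad`; `…ConeDefs.lean`: the cone laws `LawWithCone`, `IndexFormShellLawCone`; and the landed chain
`cuspTransferCone` (p76583), `syzygyTransferCone` (p76848), `fewDeepLaw_of_uniformity` (p78128)). The planner's
skeleton typed its own window `ifWin` over data `(g, u, v)` with its own conductor proxy; those are the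
companion's `ifShell`/`N5` in other clothes (the card: "companion; its `LatticeHalf` is this line's
`stub_fewDeepPrimes`"), so — CONVENTIONS §4, import, never restate — only what is NEW on this line is defined:

* §1 arithmetic pieces: `coprimePart s n` (the part of `n` prime to `s`), `sqfreeKernel n` (Kane's `T`),
  `sqPart n` (Kane's `S`, `n = T·S²` on the relevant part);
* §2 the FLAT populations over index-form data `q = g·(u,v)` of a form `F` (planner's regions, syzygy
  normalisation): `primValue` (`m = |F(u,v)|`), `mflat` (`m♭` = part of `m` prime to `6·g·Disc F`), `mMax`
  (`(2Y/|Disc F|)^{1/2}/g³ ≥ m` on the shell), and the ε-indexed regions `FewDeepFlat` (repeated radical of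
  `m♭` under Kane's cap AND `m♭` above the Hall floor `X^{−ε/4}·m_max`), `SpreadFlat` (over the cap, above
  the floor), `CornerFlat` (under the floor: the Hall / bad-prime corner), with the trichotomy `flat_cover`;
* §3 the ε-indexed cone law `LawWithConeE P c` (verbatim `LawWithCone` with the predicate allowed to see the
  law's `ε`, which the floor needs) and the glue `indexFormShellLawCone_of_flatCover`
  (three flat laws ⇒ `IndexFormShellLawCone`, union bound);
* §4 the LEVER's objects (planner's statement verbatim): `twoTorsionCard F = |Cl(R(F))[2]|`, the plane
  element `planeElt F u v = a·u + v·ω ∈ ℤ ⊕ ℤω ⊂ R(F)`, and `PlanarityFactorisation`;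
* §5 the named stub statements `FewDeepFlatLaw`, `SpreadCensusFlat`, `CornerLawFlat` and the composition
  `sharpModerateLaw_of_flat` (uniformity fact ⇒ flat few-deep law ⇒ spread law ⇒ corner law ⇒ crux).

No stub is proved here; the stubs land in their own files and the composition BY NAME in the skeleton.
-/

noncomputable section

-- the mandated summit namespace `Summit.ABC.ABC` (summit = problem) trips the duplicate-namespace linter
set_option linter.dupNamespace false

namespace Summit.ABC.ABC.Theorems.SharpModerateLaw.UnitPlane

open Literature.NumberTheory.CubicFields
open UniqueFactorizationMonoid (radical)
open scoped BigOperators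
open Finset

/-! ## 1. Arithmetic pieces -/

/-- The part of `n` coprime to `s`: `∏_{p ∣ n, p ∤ s} p^{v_p(n)}` (`= 1` for `n = 0`, junk, never used there). -/
def coprimePart (s n : ℕ) : ℕ := ∏ p ∈ n.primeFactors with ¬ p ∣ s, p ^ n.factorization p

/-- Square-free kernel `T(n) = ∏_{v_p(n) odd} p` (Kane's `T`; so `n = T(n)·S(n)²`). -/
def sqfreeKernel (n : ℕ) : ℕ := ∏ p ∈ n.primeFactors with ¬ 2 ∣ n.factorization p, p

/-- Kane's `S(n) = ∏_p p^{⌊v_p(n)/2⌋}`, the largest integer whose square divides `n`. -/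
def sqPart (n : ℕ) : ℕ := ∏ p ∈ n.primeFactors, p ^ (n.factorization p / 2)

/-! ## 2. The flat populations over index-form data

A datum of the companion's shell `ifShell F X Y` is `q = (y, z) ∈ ℤ²` with content `g = gcd(y, z)` (the
quadratic-twist parameter) and primitive part `(u, v) = q/g`; `m = |F(u, v)|`. The planner's regions are cut by
the repeated radical of `m♭` (the part of `m` prime to `6·g·Disc F`: unramified, non-content primes) against
Kane's cap, and by `m♭` against the Hall floor. -/

/-- `m = |F(u,v)|` at the primitive part `(u,v) = q / gcd(q)` of the datum `q`. -/
def primValue (F : BinaryCubic ℤ) (q : ℤ × ℤ) : ℕ :=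
  (F.eval (q.1 / (Int.gcd q.1 q.2 : ℤ)) (q.2 / (Int.gcd q.1 q.2 : ℤ))).natAbs

/-- `m♭`: the part of `m = |F(u,v)|` prime to `6 · gcd(q) · Disc F`. -/
def mflat (F : BinaryCubic ℤ) (q : ℤ × ℤ) : ℕ :=
  coprimePart (6 * Int.gcd q.1 q.2 * F.disc.natAbs) (primValue F q)

/-- `m_max(F, q, Y) = (2Y/|Disc F|)^{1/2} / g³`: on the shell `Mplus F q < 2Y` one has `|Disc F|·g⁶·m² ≤ Mplus`,
so `m ≤ m_max`. -/
def mMax (F : BinaryCubic ℤ) (q : ℤ × ℤ) (Y : ℝ) : ℝ :=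
  Real.sqrt (2 * Y / ((F.disc.natAbs : ℕ) : ℝ)) / ((Int.gcd q.1 q.2 : ℕ) : ℝ) ^ 3

/-- FEW-DEEP (flat): `g · rad(Disc F) · v(m♭) ≤ X·Y^{−1/6}` (Kane's cap, syzygy normalisation, on the FLAT part)
and `m♭ ≥ X^{−ε/4}·m_max` (above the Hall floor). -/
def FewDeepFlat (ε X Y : ℝ) (F : BinaryCubic ℤ) (q : ℤ × ℤ) : Prop :=
  ((Int.gcd q.1 q.2 : ℕ) : ℝ) * ((radical F.disc.natAbs : ℕ) : ℝ) * ((depthRad (mflat F q) : ℕ) : ℝ) ≤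
      X * Y ^ (-(1 / 6 : ℝ)) ∧
    X ^ (-(ε / 4)) * mMax F q Y ≤ (mflat F q : ℝ)

/-- SPREAD (flat): over Kane's cap on the flat part (so the square part of `m♭` is large), above the floor. -/
def SpreadFlat (ε X Y : ℝ) (F : BinaryCubic ℤ) (q : ℤ × ℤ) : Prop :=
  X * Y ^ (-(1 / 6 : ℝ)) <
      ((Int.gcd q.1 q.2 : ℕ) : ℝ) * ((radical F.disc.natAbs : ℕ) : ℝ) * ((depthRad (mflat F q) : ℕ) : ℝ) ∧
    X ^ (-(ε / 4)) * mMax F q Y ≤ (mflat F q : ℝ)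

/-- CORNER (flat): `m♭ < X^{−ε/4}·m_max` — the Hall regime `|Δ♭| ≪ M⁺` together with data whose `F`-value is
carried by ramified / content primes (the "one hard corner" of TRIAGE r1-2). -/
def CornerFlat (ε X Y : ℝ) (F : BinaryCubic ℤ) (q : ℤ × ℤ) : Prop :=
  (mflat F q : ℝ) < X ^ (-(ε / 4)) * mMax F q Y

/-- The three flat regions cover every datum. -/
theorem flat_cover (ε X Y : ℝ) (F : BinaryCubic ℤ) (q : ℤ × ℤ) :
    FewDeepFlat ε X Y F q ∨ SpreadFlat ε X Y F q ∨ CornerFlat ε X Y F q := by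
  by_cases hfloor : X ^ (-(ε / 4)) * mMax F q Y ≤ (mflat F q : ℝ)
  · rcases le_or_gt (((Int.gcd q.1 q.2 : ℕ) : ℝ) * ((radical F.disc.natAbs : ℕ) : ℝ) *
        ((depthRad (mflat F q) : ℕ) : ℝ)) (X * Y ^ (-(1 / 6 : ℝ))) with h | h
    · exact Or.inl ⟨h, hfloor⟩
    · exact Or.inr (Or.inl ⟨h, hfloor⟩)
  · exact Or.inr (Or.inr (lt_of_not_ge hfloor))

/-! ## 3. The ε-indexed cone law and the flat cover glue -/

/-- Cone-restricted dyadic law for an ε-INDEXED population `P ε` with additive constant `c` (verbatim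
`LawWithCone`, the predicate being allowed to depend on the law's `ε` — the Hall floor `X^{−ε/4}` must). -/
def LawWithConeE (P : ℝ → ℝ → ℝ → BinaryCubic ℤ → ℤ × ℤ → Prop) (c : ℝ) : Prop :=
  ∀ σ : ℝ, 6 < σ → ∀ ε : ℝ, 0 < ε → ∃ C : ℝ, ∀ X Y : ℝ, 1 ≤ X → 1 ≤ Y → X ^ 3 ≤ 2 * Y → Y ≤ 186624 * X ^ σ →
    (totalCount (P ε) X Y : ℝ) ≤ C * (X * Y) ^ ε * (X * Y ^ (-(1 / 6 : ℝ)) + c)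

/-- Every shell count splits along the flat trichotomy (the `True`-slice IS the union of the three slices;
`Set.ncard_union_le` needs no finiteness). -/
theorem shellCount_le_flatCover (ε X Y : ℝ) (F : BinaryCubic ℤ) :
    shellCount (fun _ _ _ _ => True) X Y F ≤
      shellCount (FewDeepFlat ε) X Y F + shellCount (SpreadFlat ε) X Y F + shellCount (CornerFlat ε) X Y F := by
  unfold shellCount
  have hsplit : {q : ℤ × ℤ | RingOfForm.IsMaximal F ∧ q ∈ ifShell F X Y ∧ True} =
      ({q : ℤ × ℤ | RingOfForm.IsMaximal F ∧ q ∈ ifShell F X Y ∧ FewDeepFlat ε X Y F q} ∪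
        {q : ℤ × ℤ | RingOfForm.IsMaximal F ∧ q ∈ ifShell F X Y ∧ SpreadFlat ε X Y F q}) ∪
        {q : ℤ × ℤ | RingOfForm.IsMaximal F ∧ q ∈ ifShell F X Y ∧ CornerFlat ε X Y F q} := by
    ext q
    simp only [Set.mem_setOf_eq, Set.mem_union, and_true]
    constructor
    · rintro ⟨hM, hq⟩
      rcases flat_cover ε X Y F q with h | h | h
      · exact Or.inl (Or.inl ⟨hM, hq, h⟩)
      · exact Or.inl (Or.inr ⟨hM, hq, h⟩)
      · exact Or.inr ⟨hM, hq, h⟩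
    · rintro ((⟨hM, hq, -⟩ | ⟨hM, hq, -⟩) | ⟨hM, hq, -⟩) <;> exact ⟨hM, hq⟩
  rw [hsplit]
  exact (Set.ncard_union_le _ _).trans (Nat.add_le_add_right (Set.ncard_union_le _ _) _)

/-- The total count splits along the flat trichotomy. -/
theorem totalCount_le_flatCover (ε X Y : ℝ) :
    totalCount (fun _ _ _ _ => True) X Y ≤
      totalCount (FewDeepFlat ε) X Y + totalCount (SpreadFlat ε) X Y + totalCount (CornerFlat ε) X Y := by
  unfold totalCount
  rw [← Finset.sum_add_distrib, ← Finset.sum_add_distrib]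
  refine Finset.sum_le_sum fun D hD => ?_
  have hD0 : D ≠ 0 := (Finset.mem_erase.mp hD).1
  calc orbitTotal D (shellCount (fun _ _ _ _ => True) X Y)
      ≤ orbitTotal D (fun F => shellCount (FewDeepFlat ε) X Y F + shellCount (SpreadFlat ε) X Y F) +
          orbitTotal D (shellCount (CornerFlat ε) X Y) :=
        orbitTotal_le_add' hD0 fun F => shellCount_le_flatCover ε X Y F
    _ ≤ orbitTotal D (shellCount (FewDeepFlat ε) X Y) + orbitTotal D (shellCount (SpreadFlat ε) X Y) +
          orbitTotal D (shellCount (CornerFlat ε) X Y) :=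
        Nat.add_le_add_right (orbitTotal_le_add' hD0 fun _ => le_rfl) _

/-- **Flat cover glue**: the laws on the three flat populations give the cone index-form shell law
(constants `max C₁ 0 + max C₂ 0 + max C₃ 0`). -/
theorem indexFormShellLawCone_of_flatCover (h₁ : LawWithConeE FewDeepFlat 0) (h₂ : LawWithConeE SpreadFlat 1)
    (h₃ : LawWithConeE CornerFlat 1) : IndexFormShellLawCone := by
  intro σ hσ ε hε
  obtain ⟨C₁, hC₁⟩ := h₁ σ hσ ε hε
  obtain ⟨C₂, hC₂⟩ := h₂ σ hσ ε hε
  obtain ⟨C₃, hC₃⟩ := h₃ σ hσ ε hε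
  refine ⟨max C₁ 0 + max C₂ 0 + max C₃ 0, fun X Y hX hY hc1 hc2 => ?_⟩
  have hX0 : 0 < X := by linarith
  have hY0 : 0 < Y := by linarith
  have e₁ := hC₁ X Y hX hY hc1 hc2
  have e₂ := hC₂ X Y hX hY hc1 hc2
  have e₃ := hC₃ X Y hX hY hc1 hc2
  have hsplit : (totalCount (fun _ _ _ _ => True) X Y : ℝ) ≤
      (totalCount (FewDeepFlat ε) X Y : ℝ) + (totalCount (SpreadFlat ε) X Y : ℝ) +
        (totalCount (CornerFlat ε) X Y : ℝ) := by
    exact_mod_cast totalCount_le_flatCover ε X Y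
  set E : ℝ := (X * Y) ^ ε with hE_def
  set A : ℝ := X * Y ^ (-(1 / 6 : ℝ)) with hA_def
  have hE : 0 ≤ E := Real.rpow_nonneg (by positivity) ε
  have hA : 0 ≤ A := by positivity
  have s1 : C₁ * E * (A + 0) ≤ max C₁ 0 * E * (A + 1) := by
    have t1 : C₁ * E * (A + 0) ≤ max C₁ 0 * E * (A + 0) :=
      mul_le_mul_of_nonneg_right (mul_le_mul_of_nonneg_right (le_max_left _ _) hE) (by linarith)
    have t2 : max C₁ 0 * E * (A + 0) ≤ max C₁ 0 * E * (A + 1) :=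
      mul_le_mul_of_nonneg_left (by linarith) (mul_nonneg (le_max_right _ _) hE)
    linarith
  have s2 : C₂ * E * (A + 1) ≤ max C₂ 0 * E * (A + 1) :=
    mul_le_mul_of_nonneg_right (mul_le_mul_of_nonneg_right (le_max_left _ _) hE) (by linarith)
  have s3 : C₃ * E * (A + 1) ≤ max C₃ 0 * E * (A + 1) :=
    mul_le_mul_of_nonneg_right (mul_le_mul_of_nonneg_right (le_max_left _ _) hE) (by linarith)
  calc (totalCount (fun _ _ _ _ => True) X Y : ℝ)
      ≤ (totalCount (FewDeepFlat ε) X Y : ℝ) + (totalCount (SpreadFlat ε) X Y : ℝ) +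
          (totalCount (CornerFlat ε) X Y : ℝ) := hsplit
    _ ≤ C₁ * E * (A + 0) + C₂ * E * (A + 1) + C₃ * E * (A + 1) := add_le_add (add_le_add e₁ e₂) e₃
    _ ≤ max C₁ 0 * E * (A + 1) + max C₂ 0 * E * (A + 1) + max C₃ 0 * E * (A + 1) :=
        add_le_add (add_le_add s1 s2) s3
    _ = (max C₁ 0 + max C₂ 0 + max C₃ 0) * E * (A + 1) := by ring

/-- The flat cover glue, closed form (registered sub-goal `flatCover_glue` of stmt-ABC-1975: the composition step of
the line that every stub feeds). -/
theorem flatCover_glue : LawWithConeE FewDeepFlat 0 → LawWithConeE SpreadFlat 1 → LawWithConeE CornerFlat 1 → IndexFormShellLawCone :=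
  fun h₁ h₂ h₃ => indexFormShellLawCone_of_flatCover h₁ h₂ h₃

/-! ## 4. The lever's objects (over `O = RingOfForm F`, basis `1, ω, θ`) -/

open Classical in
/-- `|Cl(O)[2]|` for the order `O = R(F)` of an irreducible form (a domain: `isDomain_of_isIrreducible`, so
Mathlib's `ClassGroup` applies); `1` for reducible forms (there the relevant 2-torsion is `≪ Disc^ε` by genus
theory and is absorbed in constants). Bounded ON AVERAGE over cubic fields ordered by discriminant
(Bhargava, Ann. Math. 162 (2005), Thm 5: means `5/4`, `3/2`). -/
def twoTorsionCard (F : BinaryCubic ℤ) : ℕ :=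
  if h : F.IsIrreducible then
    (haveI : IsDomain (RingOfForm F) := RingOfForm.isDomain_of_isIrreducible h
     Nat.card {c : ClassGroup (RingOfForm F) // c ^ 2 = 1})
  else 1

/-- The plane element `a·u + v·ω ∈ ℤ ⊕ ℤω = ker(z-coordinate) ⊂ O` attached to `(u, v)` (Delone–Faddeev
coordinates `⟨x, y, z⟩ = x + yω + zθ`); its norm is `a²·F(u, v)`, so divisibility of `F(u,v)` by squares is
divisibility of this principal ideal by squares of ideals. -/
def planeElt (F : BinaryCubic ℤ) (u v : ℤ) : RingOfForm F := ⟨F.a * u, v, 0⟩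

/-- **PLANARITY FACTORISATION** (the lever of the line, planner's statement verbatim; per irreducible
MAXIMAL form): there are a constant `C = C(F)` and finite SHAPE SETS `Λ T ⊂ O` (`T ∈ ℕ`) with
`#Λ T ≤ C·|Cl(O)[2]|·3^{ω(T)}` and `|N λ| ≤ C·T` on `Λ T`, such that for every coprime `(u, v)` with
`F(u,v) ≠ 0`, writing `T` for the square-free kernel and `S` for the square part of
`m♭ = (|F(u,v)|` prime to `6·a·Disc F)`, one has `r²·(a u + vω) = λ·β²` for some `λ ∈ Λ T`, `β ∈ O` with
`S ∣ |N β|`, and `1 ≤ r ≤ C`. (Kane arXiv:1104.2635 Prop. 9's factorisation step transplanted from `ℤ` to a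
maximal cubic order. Proof route: `O ≅ 𝓞 K` (`toRingOfIntegers_surjective`); for `p ∤ a·v` with `p ∣ N(au+vω)`
the ideal `(p, au+vω)` has quotient `ℤ/p`, so it is the unique prime over `p` through `au+vω` and has degree
one; hence `(au+vω) = 𝔞'·𝔟²` with `N𝔞' ≤ rad(a)³·6|Disc F|·T` and `S ∣ N𝔟`; integral class representatives
`𝔯` (`r = N𝔯`) give `𝔟𝔯 = (β)`, `λ = r²(au+vω)/β² ∈ O`; generators normalised modulo squares of units
(Dirichlet: `O^×/O^{×2}` finite); the class of `𝔟` lies in a coset of `Cl[2]`.) The datum `β` is then a zero of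
the PLANARITY CONIC `Q_λ(β) = z-coordinate(λβ²)`, an integral ternary quadratic form of determinant `a·N(λ)`. -/
def PlanarityFactorisation : Prop :=
  ∀ F : BinaryCubic ℤ, F.IsIrreducible → RingOfForm.IsMaximal F →
    ∃ (C : ℕ) (Λ : ℕ → Finset (RingOfForm F)), 0 < C ∧
      (∀ T : ℕ, ((Λ T).card : ℝ) ≤ C * twoTorsionCard F * 3 ^ T.primeFactors.card) ∧
      (∀ T : ℕ, ∀ l ∈ Λ T, ((Algebra.norm ℤ l).natAbs : ℝ) ≤ C * T) ∧
      ∀ u v : ℤ, IsCoprime u v → F.eval u v ≠ 0 →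
        ∃ l ∈ Λ (sqfreeKernel (coprimePart (6 * F.a.natAbs * F.disc.natAbs) (F.eval u v).natAbs)),
          ∃ β : RingOfForm F, ∃ r : ℕ, 1 ≤ r ∧ r ≤ C ∧
            ((r : RingOfForm F) ^ 2) * planeElt F u v = l * β ^ 2 ∧
            sqPart (coprimePart (6 * F.a.natAbs * F.disc.natAbs) (F.eval u v).natAbs) ∣
              (Algebra.norm ℤ β).natAbs

/-! ## 5. The named stub statements and the composition -/

/-- Statement of `stub_fewDeepFlat`: the companion's few-deep law (`LawWith FewDeep 0`, all `X, Y ≥ 1`) gives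
the law on the FLAT few-deep population (the floor bounds the ramified/content part of `m` by `X^{ε/4}`, so a
flat few-deep datum is few-deep at conductor budget `X^{1+ε/4}`; no additive constant). -/
def FewDeepFlatLaw : Prop := FewDeepLaw → LawWithConeE FewDeepFlat 0

/-- Statement of `stub_spreadCensus` (the OPEN CORE of the line): given the planarity factorisation, the law
on the spread-above-floor population — the census of planarity conics over maximal cubic rings. -/
def SpreadCensusFlat : Prop := PlanarityFactorisation → LawWithConeE SpreadFlat 1

/-- Statement of `stub_cornerLaw` (OPEN; the Hall / bad-prime corner). -/
def CornerLawFlat : Prop := LawWithConeE CornerFlat 1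

/-- **The line's composition over named statements**: the BTT uniformity fact (⇒ `FewDeepLaw`, landed
`fewDeepLaw_of_uniformity`), the flat few-deep step, the spread law and the corner law give the crux through the
landed cone transfer (`cuspTransferCone`) and cone dictionary (`syzygyTransferCone`). -/
theorem sharpModerateLaw_of_flat (hU : Literature.NumberTheory.CubicFields.btt_uniformity_sqDvd)
    (hF : FewDeepFlatLaw) (hS : LawWithConeE SpreadFlat 1) (hC : CornerLawFlat) :
    Summit.ABC.ABC.Theses.TwistAmplification.SharpModerateLaw :=
  cuspTransferCone (syzygyTransferCone
    (indexFormShellLawCone_of_flatCover (hF (fewDeepLaw_of_uniformity hU)) hS hC))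

end Summit.ABC.ABC.Theorems.SharpModerateLaw.UnitPlane

end
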